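import Literature.Algebra.Lie.QuaternionCentralizerSkewDimension
import HarnessLib

/-!
# An algebra with an anticommuting pair `i² = a`, `j² = b` and an anti-involution of ORTHOGONAL type on the pair
# (`τ i = -i`, `τ j = j`): `dim E⁻ = 3 · dim C⁻ + dim C⁺`, `8 · dim C⁻ + dim E = 4 · dim E⁻`

Topic `Literature/Algebra/Lie`.  Theorems only (no definition, no named fact).  Companion of
`Literature/Algebra/Lie/QuaternionCentralizerSkewDimension` (the case `τ i = -i`, `τ j = -j`: the canonical involution of the
quaternion subalgebra, symplectic type — type III), written for the cell `pub-hodgecm2` (COR-CM), seat `b27` (count-neutral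
Mumford–Tate-rank lane): for a simple complex abelian variety whose endomorphism algebra is a totally INDEFINITE quaternion
algebra `D` over `ℚ` (Albert type II) the Rosati involution is `x ↦ a⁻¹x̄a` with `a² = α < 0` (Lange Thm. 2.6.5 (b)); in a
quaternionic basis `i = a`, `j` (`ij = -ji`) it reads `i ↦ -i`, `j ↦ +j` (orthogonal type: `Sym = ⟨1, j, ij⟩`), and the Lefschetz
Lie algebra `C_{End V}(D) ∩ 𝔰𝔭(V, φ)` has Milne's type-II dimension `g²/2 + g/2` (Milne 1999 §2, Summary; `F = ℚ`, `dim V = 2g`).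

SETTING: `E` a finite-dimensional algebra over a field `K` with `2 ≠ 0`; `i, j ∈ E`, `i² = a`, `j² = b` (`a, b ∈ K×`), `ij = -ji`;
`C = C_E(i, j)`; `τ : E → E` linear, `τ(xy) = τ(y)τ(x)`, `τ² = 1`, **`τ(i) = -i`, `τ(j) = j`**; `E^± = ker(τ ∓ 1)`, `C^± = C ∩ E^±`.
RESULTS (namespace `Literature.Algebra.Lie.QuaternionCentralizer`):
* `finrank_ker_counts_orth` (kernel form), `finrank_centralizer_eq_add_orth` — `dim C = dim C⁺ + dim C⁻`;
* **`finrank_skew_eq_three_mul_add_orth`** — `dim E⁻ = 3 · dim C⁻ + dim C⁺`: on `iC` the involution is `-τ` transported (a copy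
  of `C⁺` in `E⁻`), on `jC` and `ijC` it is `τ` transported (two more copies of `C⁻`);
* **`eight_mul_finrank_centralizer_skew_add_orth`** — `8 · dim C⁻ + dim E = 4 · dim E⁻` (with `dim E = 4 dim C` from the companion).
  With `E = End V`, `dim V = d`, `τ` the adjoint of a symplectic form (`dim E⁻ = d(d+1)/2`): `dim C⁻ = d(d+2)/8` (`= g²/2 + g/2`,
  `d = 2g`; `= m(2m+1) = dim 𝔰𝔭_{2m}` for `d = 4m`).

## References
* [Milne1999LefschetzClasses] J. S. Milne, *Lefschetz classes on abelian varieties*, Duke Math. J. 96 (1999), §2 (simple abelian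
  variety of type II; Summary table `dim = g²/2f + g/2`).
* [Voight2021] J. Voight, *Quaternion Algebras*, GTM 288 (2021), Prop. 7.7.8 (b).
* [Lange2023AbelianVarietiesComplex] H. Lange, *Abelian Varieties over the Complex Numbers* (2023), §2.6.2 Thm. 2.6.5 (b).
-/

namespace Literature.Algebra.Lie

namespace QuaternionCentralizer

open Module

variable {K : Type*} [Field K] {E : Type*} [Ring E] [Algebra K E]

/-! ### Elementary (anti)commutation transport -/

section Transport

/-- `ux = xu ⟹ u(ux) = (ux)u`. [folklore] -/
private theorem cen_self {u x : E} (h : u * x = x * u) : u * (u * x) = u * x * u := by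
  calc u * (u * x) = u * (x * u) := by rw [h]
    _ = u * x * u := (mul_assoc _ _ _).symm

/-- `ux = -xu ⟹ u(ux) = -(ux)u`. [folklore] -/
private theorem anti_self {u x : E} (h : u * x = -(x * u)) : u * (u * x) = -(u * x * u) := by
  calc u * (u * x) = u * (-(x * u)) := by rw [h]
    _ = -(u * x * u) := by rw [mul_neg, ← mul_assoc]

/-- `uv = -vu`, `vx = xv ⟹ v(ux) = -(ux)v`. [folklore] -/
private theorem anti_of_cen {u v x : E} (huv : u * v = -(v * u)) (h : v * x = x * v) : v * (u * x) = -(u * x * v) := by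
  have hvu : v * u = -(u * v) := by rw [huv, neg_neg]
  calc v * (u * x) = v * u * x := (mul_assoc _ _ _).symm
    _ = -(u * (v * x)) := by rw [hvu, neg_mul, mul_assoc]
    _ = -(u * x * v) := by rw [h, ← mul_assoc]

/-- `uv = -vu`, `vx = -xv ⟹ v(ux) = (ux)v`. [folklore] -/
private theorem cen_of_anti {u v x : E} (huv : u * v = -(v * u)) (h : v * x = -(x * v)) : v * (u * x) = u * x * v := by
  have hvu : v * u = -(u * v) := by rw [huv, neg_neg]
  calc v * (u * x) = v * u * x := (mul_assoc _ _ _).symm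
    _ = -(u * (v * x)) := by rw [hvu, neg_mul, mul_assoc]
    _ = u * x * v := by rw [h, mul_neg, neg_neg, ← mul_assoc]

/-- `uv = -vu`, `ux = xu ⟹ u(vxv) = (vxv)u`. [folklore] -/
private theorem conj_cen {u v x : E} (huv : u * v = -(v * u)) (h : u * x = x * u) :
    u * (v * x * v) = v * x * v * u := by
  have hvu : v * u = -(u * v) := by rw [huv, neg_neg]
  calc u * (v * x * v) = u * v * x * v := by simp only [mul_assoc]
    _ = -(v * (u * x) * v) := by rw [huv]; simp only [neg_mul, mul_assoc]
    _ = -(v * x * (u * v)) := by rw [h]; simp only [mul_assoc]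
    _ = v * x * v * u := by rw [huv]; simp only [mul_neg, neg_neg, mul_assoc]

/-- `uv = -vu`, `ux = -xu ⟹ u(vxv) = -(vxv)u`. [folklore] -/
private theorem conj_anti {u v x : E} (huv : u * v = -(v * u)) (h : u * x = -(x * u)) :
    u * (v * x * v) = -(v * x * v * u) := by
  calc u * (v * x * v) = u * v * x * v := by simp only [mul_assoc]
    _ = -(v * (u * x) * v) := by rw [huv]; simp only [neg_mul, mul_assoc]
    _ = v * x * (u * v) := by rw [h]; simp only [mul_neg, neg_mul, neg_neg, mul_assoc]
    _ = -(v * x * v * u) := by rw [huv]; simp only [mul_neg, mul_assoc]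

variable (τ : E →ₗ[K] E)

/-- `τ(ux) = -τ(x)u` for an anti-homomorphism `τ` with `τu = -u`. [folklore] -/
private theorem tau_mul (hτm : ∀ x y, τ (x * y) = τ y * τ x) {u : E} (hτu : τ u = -u) (x : E) :
    τ (u * x) = -(τ x * u) := by
  rw [hτm, hτu, mul_neg]

/-- `ux = xu ⟹ u τ(x) = τ(x) u` (`τ` anti-homomorphism, `τu = -u`). [folklore] -/
private theorem tau_cen (hτm : ∀ x y, τ (x * y) = τ y * τ x) {u : E} (hτu : τ u = -u) {x : E} (h : u * x = x * u) :
    u * τ x = τ x * u := by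
  have h' := congrArg τ h
  rw [hτm, hτm, hτu, neg_mul, mul_neg, neg_inj] at h'
  exact h'.symm

/-- `ux = -xu ⟹ u τ(x) = -τ(x) u` (`τ` anti-homomorphism, `τu = -u`). [folklore] -/
private theorem tau_anti (hτm : ∀ x y, τ (x * y) = τ y * τ x) {u : E} (hτu : τ u = -u) {x : E}
    (h : u * x = -(x * u)) : u * τ x = -(τ x * u) := by
  have h' := congrArg τ h
  rw [map_neg, hτm, hτm, hτu, neg_mul, mul_neg, neg_neg] at h'
  rw [← h']

/-- `τx = -x ⟹ τ(uxu) = -(uxu)` (`τ` anti-homomorphism, `τu = -u`). [folklore] -/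
private theorem tau_conj (hτm : ∀ x y, τ (x * y) = τ y * τ x) {u : E} (hτu : τ u = -u) {x : E} (h : τ x = -x) :
    τ (u * x * u) = -(u * x * u) := by
  rw [hτm, hτm, hτu, h]
  simp only [neg_mul, mul_neg, neg_neg, mul_assoc]

/-- `τ(ux) = τ(x)u` for an anti-homomorphism `τ` with `τu = u`. [folklore] -/
private theorem tau_mul' (hτm : ∀ x y, τ (x * y) = τ y * τ x) {u : E} (hτu : τ u = u) (x : E) :
    τ (u * x) = τ x * u := by
  rw [hτm, hτu]

/-- `τx = -x ⟹ τ(uxu) = -(uxu)` (`τ` anti-homomorphism, `τu = u`). [folklore] -/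
private theorem tau_conj' (hτm : ∀ x y, τ (x * y) = τ y * τ x) {u : E} (hτu : τ u = u) {x : E} (h : τ x = -x) :
    τ (u * x * u) = -(u * x * u) := by
  rw [hτm, hτm, hτu, h]
  simp only [neg_mul, mul_neg, mul_assoc]

end Transport


/-! ### The count in the orthogonal-type case -/

variable [FiniteDimensional K E] [NeZero (2 : K)]

/-- **The `τ`-splitting of `Cᵢ ∩ Cⱼ` and of `E⁻`, orthogonal type** (kernel form, `Cᵤ = ker(Lᵤ - Rᵤ)`, `E^± = ker(τ ∓ 1)`): for a
linear anti-involution `τ` with `τ i = -i`, `τ j = j`: `dim (Cᵢ ∩ Cⱼ) = dim (Cᵢ ∩ Cⱼ ∩ E⁺) + dim (Cᵢ ∩ Cⱼ ∩ E⁻)` and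
`dim E⁻ = 3 dim (Cᵢ ∩ Cⱼ ∩ E⁻) + dim (Cᵢ ∩ Cⱼ ∩ E⁺)` — the count behind Milne's `g²/2 + g/2` for the type-II Lefschetz group.
[cite: Milne1999LefschetzClasses, §2 (type II) and Summary] [cite: Voight2021, Prop. 7.7.8 (b)] -/
theorem finrank_ker_counts_orth {i j : E} {a b : K} (ha : a ≠ 0) (hb : b ≠ 0) (hi : i * i = algebraMap K E a)
    (hj : j * j = algebraMap K E b) (hij : i * j = -(j * i)) (τ : E →ₗ[K] E)
    (hτm : ∀ x y, τ (x * y) = τ y * τ x) (hττ : ∀ x, τ (τ x) = x) (hτi : τ i = -i) (hτj : τ j = j) :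
    finrank K ↥(LinearMap.ker (LinearMap.mulLeft K i - LinearMap.mulRight K i) ⊓
          LinearMap.ker (LinearMap.mulLeft K j - LinearMap.mulRight K j)) =
        finrank K ↥(LinearMap.ker (LinearMap.mulLeft K i - LinearMap.mulRight K i) ⊓
            LinearMap.ker (LinearMap.mulLeft K j - LinearMap.mulRight K j) ⊓ LinearMap.ker (τ - LinearMap.id)) +
          finrank K ↥(LinearMap.ker (LinearMap.mulLeft K i - LinearMap.mulRight K i) ⊓
            LinearMap.ker (LinearMap.mulLeft K j - LinearMap.mulRight K j) ⊓ LinearMap.ker (τ + LinearMap.id)) ∧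
      finrank K ↥(LinearMap.ker (τ + LinearMap.id)) =
        3 * finrank K ↥(LinearMap.ker (LinearMap.mulLeft K i - LinearMap.mulRight K i) ⊓
            LinearMap.ker (LinearMap.mulLeft K j - LinearMap.mulRight K j) ⊓ LinearMap.ker (τ + LinearMap.id)) +
          finrank K ↥(LinearMap.ker (LinearMap.mulLeft K i - LinearMap.mulRight K i) ⊓
            LinearMap.ker (LinearMap.mulLeft K j - LinearMap.mulRight K j) ⊓ LinearMap.ker (τ - LinearMap.id)) := by
  set Ci := LinearMap.ker (LinearMap.mulLeft K i - LinearMap.mulRight K i) with hCi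
  set Ai := LinearMap.ker (LinearMap.mulLeft K i + LinearMap.mulRight K i) with hAi
  set Cj := LinearMap.ker (LinearMap.mulLeft K j - LinearMap.mulRight K j) with hCj
  set Aj := LinearMap.ker (LinearMap.mulLeft K j + LinearMap.mulRight K j) with hAj
  set Ep := LinearMap.ker (τ - LinearMap.id) with hEp
  set Em := LinearMap.ker (τ + LinearMap.id) with hEm
  have hji : j * i = -(i * j) := by rw [hij, neg_neg]
  have hτim := tau_mul τ hτm hτi
  have hτjm := tau_mul' τ hτm hτj
  -- `C = C⁺ ⊕ C⁻`
  have hC : finrank K ↥(Ci ⊓ Cj) = finrank K ↥(Ci ⊓ Cj ⊓ Ep) + finrank K ↥(Ci ⊓ Cj ⊓ Em) := by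
    refine finrank_eq_add_of_involutive τ hττ fun x hx => ?_
    simp only [hCi, hCj, Submodule.mem_inf, mem_ker_sub_iff] at hx ⊢
    refine ⟨tau_cen τ hτm hτi hx.1, ?_⟩
    have h' := congrArg τ hx.2
    rw [hτm, hτm, hτj] at h'
    exact h'.symm
  -- the skew part
  have hEm' : finrank K Em = finrank K ↥(Em ⊓ Ci) + finrank K ↥(Em ⊓ Ai) := by
    refine finrank_eq_add_of_conj_mem ha hi fun x hx => ?_
    simp only [hEm, mem_ker_add_id_iff] at hx ⊢
    exact tau_conj τ hτm hτi hx
  have hEmCi : finrank K ↥(Em ⊓ Ci) = finrank K ↥(Em ⊓ Ci ⊓ Cj) + finrank K ↥(Em ⊓ Ci ⊓ Aj) := by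
    refine finrank_eq_add_of_conj_mem hb hj fun x hx => ?_
    simp only [hEm, hCi, Submodule.mem_inf, mem_ker_add_id_iff, mem_ker_sub_iff] at hx ⊢
    exact ⟨tau_conj' τ hτm hτj hx.1, conj_cen hij hx.2⟩
  have hEmAi : finrank K ↥(Em ⊓ Ai) = finrank K ↥(Em ⊓ Ai ⊓ Cj) + finrank K ↥(Em ⊓ Ai ⊓ Aj) := by
    refine finrank_eq_add_of_conj_mem hb hj fun x hx => ?_
    simp only [hEm, hAi, Submodule.mem_inf, mem_ker_add_id_iff, mem_ker_add_iff] at hx ⊢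
    exact ⟨tau_conj' τ hτm hτj hx.1, conj_anti hij hx.2⟩
  -- `iC`: the involution is `-τ` transported
  have f1 : finrank K ↥(Em ⊓ Ci ⊓ Aj) = finrank K ↥(Ci ⊓ Cj ⊓ Ep) := by
    refine finrank_eq_of_mul_mem ha hi (fun x hx => ?_) (fun x hx => ?_)
    · simp only [hEm, hCi, hAj, hCj, hEp, Submodule.mem_inf, mem_ker_add_id_iff, mem_ker_sub_iff, mem_ker_add_iff,
        mem_ker_sub_id_iff] at hx ⊢
      obtain ⟨⟨hτx, hxi⟩, hxj⟩ := hx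
      refine ⟨⟨cen_self hxi, cen_of_anti hij hxj⟩, ?_⟩
      rw [hτim, hτx, neg_mul, neg_neg, hxi]
    · simp only [hEm, hCi, hAj, hCj, hEp, Submodule.mem_inf, mem_ker_add_id_iff, mem_ker_sub_iff, mem_ker_add_iff,
        mem_ker_sub_id_iff] at hx ⊢
      obtain ⟨⟨hxi, hxj⟩, hτx⟩ := hx
      refine ⟨⟨?_, cen_self hxi⟩, anti_of_cen hij hxj⟩
      rw [hτim, hτx, hxi]
  -- `jC`: the involution is `τ` transported
  have f2 : finrank K ↥(Em ⊓ Ai ⊓ Cj) = finrank K ↥(Ci ⊓ Cj ⊓ Em) := by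
    refine finrank_eq_of_mul_mem hb hj (fun x hx => ?_) (fun x hx => ?_)
    · simp only [hEm, hAi, hCj, hCi, Submodule.mem_inf, mem_ker_add_id_iff, mem_ker_sub_iff, mem_ker_add_iff] at hx ⊢
      obtain ⟨⟨hτx, hxi⟩, hxj⟩ := hx
      refine ⟨⟨cen_of_anti hji hxi, cen_self hxj⟩, ?_⟩
      rw [hτjm, hτx, neg_mul, hxj]
    · simp only [hEm, hAi, hCj, hCi, Submodule.mem_inf, mem_ker_add_id_iff, mem_ker_sub_iff, mem_ker_add_iff] at hx ⊢
      obtain ⟨⟨hxi, hxj⟩, hτx⟩ := hx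
      refine ⟨⟨?_, anti_of_cen hji hxi⟩, cen_self hxj⟩
      rw [hτjm, hτx, neg_mul, hxj]
  -- `ijC`: via `L_i` (preserves the `τ`-sign on `A_E(i)`) to `jC`
  have f3 : finrank K ↥(Em ⊓ Ai ⊓ Aj) = finrank K ↥(Em ⊓ Ai ⊓ Cj) := by
    refine finrank_eq_of_mul_mem ha hi (fun x hx => ?_) (fun x hx => ?_)
    · simp only [hEm, hAi, hAj, hCj, Submodule.mem_inf, mem_ker_add_id_iff, mem_ker_add_iff, mem_ker_sub_iff] at hx ⊢
      obtain ⟨⟨hτx, hxi⟩, hxj⟩ := hx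
      refine ⟨⟨?_, anti_self hxi⟩, cen_of_anti hij hxj⟩
      rw [hτim, hτx, neg_mul, neg_neg, ← neg_neg (x * i), ← hxi]
    · simp only [hEm, hAi, hAj, hCj, Submodule.mem_inf, mem_ker_add_id_iff, mem_ker_add_iff, mem_ker_sub_iff] at hx ⊢
      obtain ⟨⟨hτx, hxi⟩, hxj⟩ := hx
      refine ⟨⟨?_, anti_self hxi⟩, anti_of_cen hij hxj⟩
      rw [hτim, hτx, neg_mul, neg_neg, ← neg_neg (x * i), ← hxi]
  have hm : Em ⊓ Ci ⊓ Cj = Ci ⊓ Cj ⊓ Em := by rw [inf_assoc, inf_comm]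
  rw [hm] at hEmCi
  exact ⟨hC, by omega⟩

/-- **`dim C = dim C⁺ + dim C⁻`** (`C = C_E(i,j)`, `C^± = C ∩ ker(τ ∓ 1)`) for a linear anti-involution `τ` with `τ i = -i`, `τ j = j`.
[cite: Milne1999LefschetzClasses, §2 (type II) and Summary] -/
theorem finrank_centralizer_eq_add_orth {i j : E} {a b : K} (ha : a ≠ 0) (hb : b ≠ 0) (hi : i * i = algebraMap K E a)
    (hj : j * j = algebraMap K E b) (hij : i * j = -(j * i)) (τ : E →ₗ[K] E)
    (hτm : ∀ x y, τ (x * y) = τ y * τ x) (hττ : ∀ x, τ (τ x) = x) (hτi : τ i = -i) (hτj : τ j = j) :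
    finrank K ↥(Subalgebra.toSubmodule (Subalgebra.centralizer K ({i, j} : Set E))) =
      finrank K ↥(Subalgebra.toSubmodule (Subalgebra.centralizer K ({i, j} : Set E)) ⊓ LinearMap.ker (τ - LinearMap.id)) +
        finrank K ↥(Subalgebra.toSubmodule (Subalgebra.centralizer K ({i, j} : Set E)) ⊓
          LinearMap.ker (τ + LinearMap.id)) := by
  rw [toSubmodule_centralizer_pair]
  exact (finrank_ker_counts_orth ha hb hi hj hij τ hτm hττ hτi hτj).1

/-- **`dim E⁻ = 3 · dim C⁻ + dim C⁺`** for a linear anti-involution `τ` with `τ i = -i`, `τ j = j` (orthogonal type on `K⟨i, j⟩`):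
the skew part `E⁻ = ker(τ + 1)` decomposes in dimension as `C⁻ ⊕ iC⁺ ⊕ jC⁻ ⊕ ijC⁻`. [cite: Milne1999LefschetzClasses, §2 (type II) and Summary] -/
theorem finrank_skew_eq_three_mul_add_orth {i j : E} {a b : K} (ha : a ≠ 0) (hb : b ≠ 0) (hi : i * i = algebraMap K E a)
    (hj : j * j = algebraMap K E b) (hij : i * j = -(j * i)) (τ : E →ₗ[K] E)
    (hτm : ∀ x y, τ (x * y) = τ y * τ x) (hττ : ∀ x, τ (τ x) = x) (hτi : τ i = -i) (hτj : τ j = j) :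
    finrank K ↥(LinearMap.ker (τ + LinearMap.id)) =
      3 * finrank K ↥(Subalgebra.toSubmodule (Subalgebra.centralizer K ({i, j} : Set E)) ⊓ LinearMap.ker (τ + LinearMap.id)) +
        finrank K ↥(Subalgebra.toSubmodule (Subalgebra.centralizer K ({i, j} : Set E)) ⊓
          LinearMap.ker (τ - LinearMap.id)) := by
  rw [toSubmodule_centralizer_pair]
  exact (finrank_ker_counts_orth ha hb hi hj hij τ hτm hττ hτi hτj).2

/-- **`8 · dim C⁻ + dim E = 4 · dim E⁻`** in the orthogonal-type case — eliminating `dim C` and `dim C⁺` from `dim E = 4 dim C`,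
`dim C = dim C⁺ + dim C⁻`, `dim E⁻ = 3 dim C⁻ + dim C⁺`.  With `E = End V` (`dim E = d²`) and `τ` the adjoint of a symplectic form
(`dim E⁻ = d(d+1)/2`): `dim C⁻ = d(d+2)/8`, Milne's `g²/2 + g/2` (`d = 2g`). [cite: Milne1999LefschetzClasses, §2 (type II) and Summary]
[cite: Voight2021, Prop. 7.7.8 (b)] -/
theorem eight_mul_finrank_centralizer_skew_add_orth {i j : E} {a b : K} (ha : a ≠ 0) (hb : b ≠ 0)
    (hi : i * i = algebraMap K E a) (hj : j * j = algebraMap K E b) (hij : i * j = -(j * i)) (τ : E →ₗ[K] E)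
    (hτm : ∀ x y, τ (x * y) = τ y * τ x) (hττ : ∀ x, τ (τ x) = x) (hτi : τ i = -i) (hτj : τ j = j) :
    8 * finrank K ↥(Subalgebra.toSubmodule (Subalgebra.centralizer K ({i, j} : Set E)) ⊓
        LinearMap.ker (τ + LinearMap.id)) + finrank K E = 4 * finrank K ↥(LinearMap.ker (τ + LinearMap.id)) := by
  have h1 := finrank_eq_four_mul_finrank_centralizer ha hb hi hj hij
  have h2 := finrank_centralizer_eq_add_orth ha hb hi hj hij τ hτm hττ hτi hτj
  have h3 := finrank_skew_eq_three_mul_add_orth ha hb hi hj hij τ hτm hττ hτi hτj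
  omega

end QuaternionCentralizer

end Literature.Algebra.Lie
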